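import Summits.QuantumFields.YangMills.Theorems.BalabanUVNodesN22WindowedNE9DichotomyLetter
import Literature.MathematicalPhysics.QuantumFieldTheory.Balaban1983to89.Node00.RateRecordW1Maps

/-!
# BalabanUVNodes ∕ node N22 = NE9 — PRINT's DICHOTOMY IN KERNEL CURRENCY, THE LAST COUPLING AT NODE N09's OBJECT: the OUTPUT-level last-coupling datum of
# J33 IS N09's `EHoloAt` family at node00-def-W1's towers of record (`sfTowerOfRecord`), and the (β′) letter with that datum DISCHARGED by name

Cell `pub-ymgap`, HUMAN RULING D-0062 (Track A), R134 seat `pub-ymgap-dag-n22-c` (strategy s1), generation 13, module J33 part 3.  THEOREMS ONLY (no `def`, no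
`sorry`); imports part 2 `…Theorems.BalabanUVNodesN22WindowedNE9DichotomyLetter` (`windowedNE9_localizedSum_of_olderCoordHolo_lastOutputHolo`) and node00-def-W1's
`Node00.RateRecordW1Maps` (p462331 lineage: `sfTowerOfRecord`, `lastOut_of_eHoloAt` — N09's `B12BetaHolo.EHoloAt` read on W1's towers) — consumed BY NAME.  Filed
`--supports stmt-QuantumFields-20544` (K3⁷) as a HELPER.

WHY.  Parts 1–2 display the last coupling's regularity as an OUTPUT-level datum of `EHoloAt` SHAPE on the box prefixes.  Node N09's typed object is
`EHoloAt (sfTowerOfRecord Sg Rz M S ⟨g, β⟩ logZ) c k` — one per window history `g` and step `k`, at the space table of record `U^c_{k+1}(X, α₀, α₁)` (`spaceI`).  THIS FILE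
is the one-line instance (as dag-n22-d's p452370 and this seat's `…N22W1StripOnDomain` §3 were in the old currency): a box prefix is the restriction of the window
history extending it by its own `0`-th coupling (J31's device), `lastOut_of_eHoloAt` gives the extension, and `termC_succ` + `restrictPrefix_update` identify its trace
with `E^{(k+1)}(X; p|p_k := t; φ)`.  So in the (β′) letter the last-coupling input is LITERALLY N09's object family with uniform letters `(E₀, r_E)` — nothing of this
lane's making.

WHAT.  `lastOutputHolo_of_eHoloAt` (N09's family along `Window γ` ⟹ part 1 §3's datum at `sp := spaceI …`, every level, `B = E₀`, `κ_E = c.κ`); ★★★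
`windowedNE9_localizedSum_of_olderCoordHolo_eHoloAt` (the (β′) letter at the space tables of record from printed (2.38) + OLDER activity margins + N09's `EHoloAt`
families + the readings ∕ tails ∕ numerals of (A); last letter `4E₀∕r_E`).

HONEST FRAMING.  Count-neutral by-name instance; no estimate of Bałaban's is proved or asserted.  DISPLAYED with owners: printed (2.38) on the boxes (N10), the older
activity margins (N10's T-row complexified ∕ NODE A), N09's `EHoloAt` FAMILY at the towers of record with uniform letters (node N09 — its existence at Bałaban's
objects is N09's theorem, not claimed here), the readings ∕ tails ∕ numerals as in (A).  Nothing of Bałaban's constructed; N22 NOT discharged (typed 28∕28 · discharged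
5∕27 UNCHANGED); K3⁷ OPEN; one finite four-torus programme at fixed ε — NOT infinite volume, NOT OS on ℝ⁴, NOT a mass gap, NOT Clay.  0 `sorry`, 0 `def`, standard
axioms.  References (TYPES only): [I] = [Balaban1987RG1] CMP 109 (1987) §1 p. 263 (clause before (1.18)), (1.18), (1.20)–(1.21) p. 264, (5.10) p. 293; [II] =
[Balaban1988RG2Cluster] CMP 116 (1988) (2.3) p. 12, (2.13) p. 14, (2.38) p. 20, (2.39)–(2.41) p. 21.
-/

noncomputable section

open Filter Topology Set Metric
open scoped BigOperators

namespace YMDAG.N22.Dichotomy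

open Literature.MathematicalPhysics.QuantumFieldTheory.Balaban1983to89
open Literature.MathematicalPhysics.QuantumFieldTheory.Balaban1983to89.T4Continuum (T4Family)
open Literature.MathematicalPhysics.QuantumFieldTheory.Balaban1983to89.T4OutputRate (Window)
open Literature.MathematicalPhysics.QuantumFieldTheory.Balaban1983to89.TreeLengthTorus (TPt torusTreeLen torusTreeLen_nonneg)
open Literature.MathematicalPhysics.QuantumFieldTheory.Balaban1983to89.B12TreeDecay (K₀ kappa₀ K₀_pos)
open Literature.MathematicalPhysics.QuantumFieldTheory.Balaban1983to89.B12Decay510 (delta1)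
open Literature.MathematicalPhysics.QuantumFieldTheory.Balaban1983to89.B12Decay510Window (K₁)
open Literature.MathematicalPhysics.QuantumFieldTheory.Balaban1983to89.B12Decay510Torus (distCT nearT)
open Literature.MathematicalPhysics.QuantumFieldTheory.Balaban1983to89.B12BetaHolo (EHoloAt)
open Literature.MathematicalPhysics.QuantumFieldTheory.Balaban1983to89.Step (SFConsts)
open Literature.MathematicalPhysics.QuantumFieldTheory.Balaban1983to89.Node00
open Literature.MathematicalPhysics.QuantumFieldTheory.Balaban1983to89.Node00.Sect2 (domSys domCount CPair spaceI domSites Setting Residual)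
open Literature.MathematicalPhysics.QuantumFieldTheory.Balaban1983to89.Node00.W1
open Literature.MathematicalPhysics.QuantumFieldTheory.Balaban1983to89.Node00.LocalizedSum17 (localizedSum ReadingMaps)
open Literature.MathematicalPhysics.QuantumFieldTheory.Balaban1983to89.Node00.U3OfKernels (histPrefix histPrefix_apply)
open Literature.MathematicalPhysics.QuantumFieldTheory.Balaban1983to89.Node00.U3KernelLetters (WindowedNE9)
open YMDAG.N22.W1 (restrictPrefix_update)

section Step

variable (F : T4Family) (K : ℕ) {𝔸 : Type*} [NormedRing 𝔸] [NormedAlgebra ℂ 𝔸] [CompleteSpace 𝔸] {G : Type*} [GaugeGroup G] {M : ℕ}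
  (Sg : Setting 𝔸 G) (Rz : Residual (F.P K) 𝔸) (logZ : ℕ → GaugeField (F.P K) 0 G → ℝ) (β : ℕ → ℝ → ℝ)

open Classical in
/-- **N09's `EHoloAt` FAMILY ⟹ THE OUTPUT-LEVEL LAST-COUPLING DATUM OF J33** at the space table of record.  One `EHoloAt (sfTowerOfRecord Sg Rz M S ⟨g, β⟩ logZ) c k` per
window history `g ∈ ]0, γ]^ℕ` (`γ ≤ c.γ`) and step `k`, with uniform letters `H.E₀ ≤ E₀`, `r_E ≤ H.r`, gives for every level `k`, box prefix `p`, `X ∈ 𝐃_{k+1}` and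
`φ ∈ U^c_{k+1}(X, c.α₀, c.α₁)`: a holomorphic extension of `t ↦ E^{(k+1)}(X; p|p_k := t; φ)` on a set containing the closed `r_E`-discs about `]0, γ]`, bounded by
`E₀·e^{−c.κ d_{k+1}(X)}` — def-W1's `lastOut_of_eHoloAt` at the window history extending `p` by its own `0`-th coupling, `termC_succ`, `restrictPrefix_update`.
[cite: Balaban1987RG1, §1 p.263 (clause before (1.18)) with (1.18); Balaban1988RG2Cluster, (2.13) p.14] -/
theorem lastOutputHolo_of_eHoloAt (S : ClusterTower (F.P K) 𝔸 M) {c : SFConsts} {γ rE E₀ : ℝ} (hγ : γ ≤ c.γ)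
    (hE : ∀ g ∈ Window γ, ∀ k : ℕ, ∃ H : EHoloAt (sfTowerOfRecord Sg Rz M S ⟨g, β⟩ logZ) c k, H.E₀ ≤ E₀ ∧ rE ≤ H.r) (k : ℕ) :
    ∀ p ∈ box γ k, ∀ (X : (domSys (F.P K) M (k + 1)).Dom), ∀ φ ∈ spaceI Sg Rz M (k + 1) (domSites (F.P K) M (k + 1) X) c.α₀ c.α₁,
      ∃ (Ec : ℂ → ℂ) (O : Set ℂ), DifferentiableOn ℂ Ec O ∧ (∀ t ∈ Ioc (0 : ℝ) γ, closedBall (t : ℂ) rE ⊆ O) ∧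
        (∀ z ∈ O, ‖Ec z‖ ≤ E₀ * Real.exp (-(c.κ * torusTreeLen X.1))) ∧
        (∀ t ∈ Ioc (0 : ℝ) γ, Ec t = (S k).E (Function.update p (Fin.last k) t) φ X) := by
  intro p hp X φ hφ
  -- extend the prefix to a window history by its own `0`-th coupling
  obtain ⟨g, hg⟩ : ∃ g : ℕ → ℝ, g = fun n => if h : n < k + 1 then p ⟨n, h⟩ else p 0 := ⟨_, rfl⟩
  have hgn : ∀ n (hn : n < k + 1), g n = p ⟨n, hn⟩ := fun n hn => by rw [hg]; exact dif_pos hn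
  have hres : restrictPrefix k g = p := funext fun j => by rw [restrictPrefix_apply, hgn j j.2]
  have hgW : g ∈ Window γ := by
    intro n
    by_cases hn : n < k + 1
    · rw [hgn n hn]; exact hp ⟨n, hn⟩
    · have e : g n = p 0 := by rw [hg]; exact dif_neg hn
      rw [e]; exact hp 0
  obtain ⟨Ec, O, -, hdisc, hhol, hbd, hrep⟩ := lastOut_of_eHoloAt Sg Rz M S logZ β hγ hE k g hgW X φ hφ
  refine ⟨Ec, O, hhol, hdisc, hbd, fun t ht => ?_⟩
  have hupd : restrictPrefix k (Function.update g k t) = Function.update p (Fin.last k) t := by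
    have h := restrictPrefix_update k g (Fin.last k) t
    rw [Fin.val_last] at h
    rw [h, hres]
  rw [hrep t ht, termC_succ, hupd]

end Step

/-! ## ★★★ The (β′) letter at the space tables of record with N09's `EHoloAt` families as the last-coupling input -/

section Letter

variable (F : T4Family) {𝔄 : Type*} [NormedRing 𝔄] [NormedAlgebra ℝ 𝔄] {V : Type*} [NormedAddCommGroup V] [NormedSpace ℝ V]
  {ι' : Type*} [Fintype ι'] {𝔸 : Type*} [NormedRing 𝔸] [NormedAlgebra ℂ 𝔸] [CompleteSpace 𝔸] {G : Type*} [GaugeGroup G] {M : ℕ}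

open Classical in
/-- ★★★ **THE (β′) LETTER FROM OLDER ACTIVITY MARGINS + NODE N09's `EHoloAt` FAMILIES.**  Part 2's `windowedNE9_localizedSum_of_olderCoordHolo_lastOutputHolo` at the space tables
of record `sp K k X := U^c_{k+1}(X, c.α₀, c.α₁)` of the `K`-th torus's setting `(Sg K, Rz K)`, with the OUTPUT-level last-coupling datum DISCHARGED by
`lastOutputHolo_of_eHoloAt` from one `EHoloAt (sfTowerOfRecord (Sg K) (Rz K) M (S K) ⟨g, β K⟩ (logZ K)) c k` per torus, window history and step (uniform letters `E₀`, `r_E`;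
`W ⊆ Window γ`, `γ ≤ c.γ`, `κ ≤ c.κ`).  Inputs displayed with owners: printed (2.38) on the boxes (N10), older activity margins `ϱt` (N10's T-row complexified ∕ NODE A),
N09's `EHoloAt` families (N09), activity holomorphy through the readings + chart ∕ space clauses + tails + numerals as in (A).  Moduli `C·Λ^D`,
`Λ^D n i = if i + 1 < n then c₀·4A∕ϱt n i else 4E₀∕r_E`. [cite: Balaban1987RG1, §1 p.263 (clause before (1.18)), (1.18), (1.7) p.261, (1.20)-(1.21) p.264 and (5.10) p.293; Balaban1988RG2Cluster, (2.3) p.12, (2.13) p.14, (2.38) p.20 and (2.39)-(2.41) p.21] -/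
theorem windowedNE9_localizedSum_of_olderCoordHolo_eHoloAt (m' : ℕ) (M : ℕ) [NeZero M] (hM : M = F.L ^ m')
    (S : (K : ℕ) → ClusterTower (F.P K) 𝔸 M) (emb : ReadingMaps F 𝔄 𝔸) (ρ : V →L[ℝ] 𝔄) (bV : Module.Basis ι' ℝ V)
    (Sg : (K : ℕ) → Setting 𝔸 G) (Rz : (K : ℕ) → Residual (F.P K) 𝔸) (logZ : (K : ℕ) → ℕ → GaugeField (F.P K) 0 G → ℝ) (β : ℕ → ℕ → ℝ → ℝ)
    (c : SFConsts) {γ : ℝ} (W : Set (ℕ → ℝ)) (hWγ : W ⊆ Window γ) (hγ : γ ≤ c.γ)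
    {A R r₁ κ δ₀ B₃ r E₀ rE : ℝ} (ϱt : ℕ → ℕ → ℝ) (hϱt : ∀ n i, 0 < ϱt n i)
    (hA : 0 < A) (hr₁ : 0 ≤ r₁) (hκ : κ ≤ r₁) (hκ₀ : kappa₀ (4 * 2 ^ 4) (2 * 4) ≤ κ / 2) (hrate : r₁ + 2 * (64 * Real.log 162) + 2 ≤ R)
    (hsmall : 2 * A * Real.exp (5 * r₁ + 1) * K₀ 64 8 * 9 * 64 ≤ 1) (hδ₀ : 0 < δ₀) (hB₃ : 0 ≤ B₃) (hr : 0 < r)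
    (hE₀ : 0 ≤ E₀) (hrE : 0 < rE) (hκc : κ ≤ c.κ)
    (h238 : ∀ K k, ((S K) k).Bound238 (box γ k) (fun X => spaceI (Sg K) (Rz K) M (k + 1) (domSites (F.P K) M (k + 1) X) c.α₀ c.α₁) A R)
    (hO : ∀ (K k : ℕ), ∀ g ∈ box γ k, ∀ (Z : (domSys (F.P K) M (k + 1)).Dom),
      ∀ φ ∈ spaceI (Sg K) (Rz K) M (k + 1) (domSites (F.P K) M (k + 1) Z) c.α₀ c.α₁, ∀ i : Fin (k + 1), (i : ℕ) < k →
      ∃ (Hc : ℂ → ℂ) (O : Set ℂ), DifferentiableOn ℂ Hc O ∧ (∀ t ∈ Ioc (0 : ℝ) γ, closedBall (t : ℂ) (ϱt (k + 1) i) ⊆ O) ∧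
        (∀ z ∈ O, ‖Hc z‖ ≤ A * Real.exp (-(R * (domSys (F.P K) M (k + 1)).dj Z))) ∧
        (∀ t ∈ Ioc (0 : ℝ) γ, Hc t = ((S K) k).H (Function.update g i t) φ Z))
    (hE : ∀ (K : ℕ), ∀ g ∈ Window γ, ∀ k : ℕ, ∃ H : EHoloAt (sfTowerOfRecord (Sg K) (Rz K) M (S K) ⟨g, β K⟩ (logZ K)) c k, H.E₀ ≤ E₀ ∧ rE ≤ H.r)
    (Ec : ℕ → ℕ → Type*) [∀ K k, NormedAddCommGroup (Ec K k)] [∀ K k, NormedSpace ℂ (Ec K k)]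
    (ι : (K k : ℕ) → (domSys (F.P K) M (k + 1)).Dom → ((Fin (F.P K).d → Site (F.P K) (k + 1) → V) →L[ℝ] Ec K k))
    (Φ : (K k : ℕ) → (domSys (F.P K) M (k + 1)).Dom → Ec K k → CPair (F.P K) 𝔸)
    (U : (K k : ℕ) → (domSys (F.P K) M (k + 1)).Dom → Set (Ec K k)) (hU : ∀ K k X, IsOpen (U K k X)) (hrU : ∀ K k X, ball (0 : Ec K k) r ⊆ U K k X)
    (hHhol : ∀ g ∈ W, ∀ (K k : ℕ) (X Z : (domSys (F.P K) M (k + 1)).Dom), Z.1 ⊆ X.1 →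
      DifferentiableOn ℂ (fun z => ((S K) k).H (histPrefix g k) (Φ K k X z) Z) (U K k X))
    (hΦemb : ∀ (K k : ℕ) (X : (domSys (F.P K) M (k + 1)).Dom) (B : Fin (F.P K).d → Site (F.P K) (k + 1) → V),
      Φ K k X (ι K k X B) = emb K k (fun l t => NormedSpace.exp (ρ (B l t))))
    (hΦsp : ∀ (K k : ℕ) (X : (domSys (F.P K) M (k + 1)).Dom), ∀ z ∈ U K k X, ∀ Z : (domSys (F.P K) M (k + 1)).Dom, Z.1 ⊆ X.1 →
      Φ K k X z ∈ spaceI (Sg K) (Rz K) M (k + 1) (domSites (F.P K) M (k + 1) Z) c.α₀ c.α₁)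
    (w : (K k : ℕ) → (domSys (F.P K) M (k + 1)).Dom → Site (F.P K) (k + 1) → ℝ) (hw₀ : ∀ K k X t, 0 ≤ w K k X t)
    (hw : ∀ (K k : ℕ) (X : (domSys (F.P K) M (k + 1)).Dom) (l : Fin (F.P K).d) (t : Site (F.P K) (k + 1)) (c : ι'),
      ‖ι K k X (Pi.single l (Pi.single t (bV c)))‖ ≤ w K k X t)
    (htail : ∀ (K k : ℕ) (X : (domSys (F.P K) M (k + 1)).Dom) (t : Site (F.P K) (k + 1)),
      let e : Site (F.P K) (k + 1) → TPt 4 (domCount (F.P K) M (k + 1) * M) := fun x i => (ZMod.cast (x i) : ZMod (domCount (F.P K) M (k + 1) * M))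
      w K k X t ≤ B₃ * Real.exp (-δ₀ * distCT (domCount (F.P K) M (k + 1)) M (e t) (nearT (M := M) (e t) X))) :
    WindowedNE9 F (localizedSum F S emb) ρ bV W (delta1 δ₀ κ ((M : ℝ) * 4))
      (fun n i => 16 * B₃ ^ 2 / r ^ 2 * Real.exp (delta1 δ₀ κ ((M : ℝ) * 4) * ((M : ℝ) * 4) * 3) * K₀ (4 * 2 ^ 4) (2 * 4) * K₁ 4 (δ₀ / 2) *
        (if i + 1 < n then 8 * (Real.exp 1 * 9 * 64 * K₀ 64 8 ^ 2) * (4 * A / ϱt n i) else 4 * E₀ / rE)) :=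
  windowedNE9_localizedSum_of_olderCoordHolo_lastOutputHolo F m' M hM S emb ρ bV W hWγ
    (fun K k X => spaceI (Sg K) (Rz K) M (k + 1) (domSites (F.P K) M (k + 1) X) c.α₀ c.α₁) ϱt hϱt hA hr₁ hκ hκ₀ hrate hsmall hδ₀ hB₃ hr
    hE₀ hrE hκc h238 hO (fun K k => lastOutputHolo_of_eHoloAt F K (Sg K) (Rz K) (logZ K) (β K) (S K) hγ (hE K) k)
    Ec ι Φ U hU hrU hHhol hΦemb hΦsp w hw₀ hw htail

end Letter

end YMDAG.N22.Dichotomy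

end
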